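import Summits.AtomisticToContinuum.Crystallization.Theorems.FrustratedLawDichotomyStrainedPatchHomLeafTableSoundHcp
import Summits.AtomisticToContinuum.Crystallization.Theorems.FrustratedLawDichotomyStrainedPatchHomLatticeBoxHcp
import Summits.AtomisticToContinuum.Crystallization.Theorems.FrustratedLawDichotomyStrainedPatchHomGram

/-!
# hcp table leaf checker — from the points form to the TWO LABEL SUMS (frame-generic), and the hcp frame facts (far labels, coverage)

decomp-a2c hand-2 g24 (crux `AperiodicFrustratedLawGap`, stmt-AtomisticToContinuum-27623; β2-hcp, critic rows 864/865).

* §1 the CLASS POINT `xH U f t : Fin 10 → ℝ` of a deformation and the term identities `Σⱼ L_lⱼ xⱼ = ‖latPt U f b‖²` (unshifted record) /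
  `= ‖latPt U f b + U t‖²` (shifted record);
* §2 ★★ `leafCheckH_sound_frame` (ANY frame `f`, shift `t`): `leafCheckH … = true` + the class point in the class box + every box label of either family is
  a record of the list or FAR ⟹ `±aμ/(2·SC) ≤ Σ_{b ∈ [−7,7]³∖0} W₄₅‖latPt U f b‖ + Σ_{b ∈ [−7,7]³} W₄₅‖latPt U f b + U t‖`;
* §3 the hcp frame: the integer norms `nU9 b = 9‖P b‖²`, `nS9 b = 9‖P b + hcpShift‖²` (`P = latPt 1 hexFrame`), the FAR LEMMAS from `‖U − 1‖ ≤ 1/4`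
  (and `|ξᵢ| ≤ 1/4` for the shifted family): `nU9 b ≥ 324 ⟹ ‖latPt U hexFrame b‖ ≥ 9/2`, `nS9 b ≥ 378 ⟹ ‖latPt U hexFrame b + U (hcpShift + ξ)‖ ≥ 9/2`;
* §4 the Boolean COVERAGE certificate `coverH labs` (every label of `[−7,7]³∖0` below `324` is an unshifted record, every label of `[−7,7]³` below `378` a
  shifted one) and ★★★ `leafCheckH_sound_hcp`.
0 sorry; standard axioms.  `--supports stmt-AtomisticToContinuum-27623`.
-/

noncomputable section

namespace Summit.AtomisticToContinuum.Crystallization.Theorems.FrustratedLawDichotomyStrainedPatchHomLeafTableCheckHcp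

open scoped BigOperators RealInnerProductSpace
open Set
open Literature.Analysis.ValidatedNumerics.Numerics
open Summit.AtomisticToContinuum.Crystallization.Theorems.ChargedEnergyGapNegative (E3)
open Summit.AtomisticToContinuum.Crystallization.Theorems.FrustratedLawDichotomySchurCut (effPot w₄₅ ω₄)
open Summit.AtomisticToContinuum.Crystallization.Theorems.FrustratedLawDichotomyStrainedPatchHomSplit (latPt hexFrame hcpShift)
open Summit.AtomisticToContinuum.Crystallization.Theorems.FrustratedLawDichotomyStrainedPatchHomGram (norm_sq_latPt_eq_sum_gram norm_sq_latPt_add_eq_sum_gram)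
open Summit.AtomisticToContinuum.Crystallization.Theorems.FrustratedLawDichotomyStrainedPatchHomTermCalculus (effPot45_eq_far)
open Summit.AtomisticToContinuum.Crystallization.Theorems.FrustratedLawDichotomyStrainedPatchHomLatticeBox (norm_apply_ge_of_near_one)
open Summit.AtomisticToContinuum.Crystallization.Theorems.FrustratedLawDichotomyStrainedPatchHomLatticeBoxHcp
  (norm_sq_hexPt norm_sq_hexPt_add_shift shifted_eq_apply latPt_eq_apply_one)
open Summit.AtomisticToContinuum.Crystallization.Theorems.FrustratedLawDichotomyStrainedPatchHomLeafTableCheck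
  (Row QT sgnZ SCN addP addN sx absDiff)

/-! ## §1. The class point and the term identities -/

/-- The CLASS POINT of a deformation `(U, f, t)`: `(g₀₀, g₁₁, g₂₂, g₀₁+g₁₀, g₀₂+g₂₀, g₁₂+g₂₁, h₀, h₁, h₂, τ)`. -/
def xH (U : E3 →L[ℝ] E3) (f : Fin 3 → E3) (t : E3) : Fin 10 → ℝ :=
  ![⟪U (f 0), U (f 0)⟫, ⟪U (f 1), U (f 1)⟫, ⟪U (f 2), U (f 2)⟫, ⟪U (f 0), U (f 1)⟫ + ⟪U (f 1), U (f 0)⟫, ⟪U (f 0), U (f 2)⟫ + ⟪U (f 2), U (f 0)⟫,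
    ⟪U (f 1), U (f 2)⟫ + ⟪U (f 2), U (f 1)⟫, ⟪U (f 0), U t⟫, ⟪U (f 1), U t⟫, ⟪U (f 2), U t⟫, ‖U t‖ ^ 2]

/-- Unshifted record: `Σⱼ L_lⱼ xⱼ = ‖latPt U f b‖²`. [folklore] -/
theorem sum_Lz_xH_of_fam_false (U : E3 →L[ℝ] E3) (f : Fin 3 → E3) (t : E3) {l : NH} (hl : l.fam = false) :
    ∑ j, ((l.Lz j : ℤ) : ℝ) * xH U f t j = ‖latPt U f l.toLab‖ ^ 2 := by
  rw [norm_sq_latPt_eq_sum_gram]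
  simp only [Fin.sum_univ_succ, Fin.sum_univ_zero, NH.Lz, xH, NH.toLab, hl, famZ]
  simp only [Fin.isValue, Matrix.cons_val_zero, Matrix.cons_val_succ, Fin.succ_zero_eq_one, Fin.succ_one_eq_two, Matrix.cons_val]
  push_cast
  rw [real_inner_comm (U (f 0)) (U (f 1)), real_inner_comm (U (f 0)) (U (f 2)), real_inner_comm (U (f 1)) (U (f 2))]
  ring

/-- Shifted record: `Σⱼ L_lⱼ xⱼ = ‖latPt U f b + U t‖²`. [folklore] -/
theorem sum_Lz_xH_of_fam_true (U : E3 →L[ℝ] E3) (f : Fin 3 → E3) (t : E3) {l : NH} (hl : l.fam = true) :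
    ∑ j, ((l.Lz j : ℤ) : ℝ) * xH U f t j = ‖latPt U f l.toLab + U t‖ ^ 2 := by
  rw [norm_sq_latPt_add_eq_sum_gram]
  simp only [Fin.sum_univ_succ, Fin.sum_univ_zero, NH.Lz, xH, NH.toLab, hl, famZ]
  simp only [Fin.isValue, Matrix.cons_val_zero, Matrix.cons_val_succ, Fin.succ_zero_eq_one, Fin.succ_one_eq_two, Matrix.cons_val]
  push_cast
  rw [real_inner_comm (U (f 0)) (U (f 1)), real_inner_comm (U (f 0)) (U (f 2)), real_inner_comm (U (f 1)) (U (f 2))]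
  ring

/-- `W(√(‖v‖²)) = W ‖v‖`. [formal bookkeeping] -/
theorem effPot_sqrt_sq (v : E3) : effPot w₄₅ ω₄ (3 / 400) (Real.sqrt (‖v‖ ^ 2)) = effPot w₄₅ ω₄ (3 / 400) ‖v‖ := by
  rw [Real.sqrt_sq (norm_nonneg _)]

/-- `81/4 ≤ ‖v‖² ⟹ 9/2 ≤ ‖v‖`. [formal bookkeeping] -/
theorem far_of_sq_ge {v : E3} (h : (81 : ℝ) / 4 ≤ ‖v‖ ^ 2) : 9 / 2 ≤ ‖v‖ := by
  nlinarith [norm_nonneg v]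

/-! ## §2. ★★ From the points form to the two label sums (any frame) -/

open Classical in
/-- ★★ **SOUNDNESS OF THE hcp TABLE LEAF CHECK, label-sum form, generic frame and shift.** [folklore] -/
theorem leafCheckH_sound_frame {tab : QT} {labs : List NH} {E A0 A1 A2 A3 A4 A5 A6 A7 A8 A9 : ℕ} {k : LH} {sμ : Bool} {aμ : ℕ}
    (htab : TabSem E tab) (hok : ∀ l ∈ labs, l.ok = true) (hkey : (labs.map (fun l => (l.fam, l.toLab))).Nodup)
    (hA : ∀ j : Fin 10, (labs.map (fun l => l.mag j)).sum ≤ vec10 A0 A1 A2 A3 A4 A5 A6 A7 A8 A9 j)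
    (hmemU : ∀ l ∈ labs, l.fam = false → l.toLab ∈ (Fintype.piFinset fun _ : Fin 3 => Finset.Icc (-7 : ℤ) 7).filter (fun b => b ≠ 0))
    (hmemS : ∀ l ∈ labs, l.fam = true → l.toLab ∈ (Fintype.piFinset fun _ : Fin 3 => Finset.Icc (-7 : ℤ) 7))
    (h : leafCheckH tab labs E A0 A1 A2 A3 A4 A5 A6 A7 A8 A9 k sμ aμ = true) (f : Fin 3 → E3) (U : E3 →L[ℝ] E3) (t : E3)
    (hbox : ∀ j, |xH U f t j - ((k.cZ j : ℤ) : ℝ) / SC| ≤ ((k.wN j : ℕ) : ℝ) / SC)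
    (hcovU : ∀ b ∈ (Fintype.piFinset fun _ : Fin 3 => Finset.Icc (-7 : ℤ) 7).filter (fun b => b ≠ 0),
      (∃ l ∈ labs, l.fam = false ∧ l.toLab = b) ∨ 9 / 2 ≤ ‖latPt U f b‖)
    (hcovS : ∀ b ∈ (Fintype.piFinset fun _ : Fin 3 => Finset.Icc (-7 : ℤ) 7),
      (∃ l ∈ labs, l.fam = true ∧ l.toLab = b) ∨ 9 / 2 ≤ ‖latPt U f b + U t‖) :
    ((sgnZ sμ aμ : ℤ) : ℝ) / SC / 2 ≤
      ∑ b ∈ (Fintype.piFinset fun _ : Fin 3 => Finset.Icc (-7 : ℤ) 7).filter (fun b => b ≠ 0), effPot w₄₅ ω₄ (3 / 400) ‖latPt U f b‖ +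
        ∑ b ∈ (Fintype.piFinset fun _ : Fin 3 => Finset.Icc (-7 : ℤ) 7), effPot w₄₅ ω₄ (3 / 400) ‖latPt U f b + U t‖ := by
  classical
  have hnd : labs.Nodup := hkey.of_map _
  obtain ⟨hpts, hfar⟩ := leafCheckH_sound_points htab hok hnd hA h (xH U f t) hbox
  set box := (Fintype.piFinset fun _ : Fin 3 => Finset.Icc (-7 : ℤ) 7).filter (fun b => b ≠ 0) with hboxdef
  set boxF := (Fintype.piFinset fun _ : Fin 3 => Finset.Icc (-7 : ℤ) 7) with hboxFdef
  set S := (labs.filter (fun l => treatedH tab k l)).toFinset with hSdef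
  have hSmem : ∀ l ∈ S, l ∈ labs ∧ treatedH tab k l = true := fun l hl => by
    have := List.mem_toFinset.1 (hSdef ▸ hl); exact ⟨List.mem_of_mem_filter this, (List.mem_filter.1 this).2⟩
  -- the treated sum, term by term
  set Φ : NH → ℝ := fun l => effPot w₄₅ ω₄ (3 / 400) (Real.sqrt (∑ j, ((l.Lz j : ℤ) : ℝ) * xH U f t j)) with hΦ
  have hΦU : ∀ l, l.fam = false → Φ l = effPot w₄₅ ω₄ (3 / 400) ‖latPt U f l.toLab‖ := fun l hl => by
    simp only [hΦ]; rw [sum_Lz_xH_of_fam_false U f t hl, effPot_sqrt_sq]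
  have hΦS : ∀ l, l.fam = true → Φ l = effPot w₄₅ ω₄ (3 / 400) ‖latPt U f l.toLab + U t‖ := fun l hl => by
    simp only [hΦ]; rw [sum_Lz_xH_of_fam_true U f t hl, effPot_sqrt_sq]
  -- split the treated set by family
  set S0 := S.filter (fun l => l.fam = false) with hS0
  set S1 := S.filter (fun l => ¬ l.fam = false) with hS1
  have hsplit : ∑ l ∈ S, Φ l = ∑ l ∈ S0, Φ l + ∑ l ∈ S1, Φ l := (Finset.sum_filter_add_sum_filter_not S _ Φ).symm
  -- injectivity of the label on each family part
  have hinj_key : Set.InjOn (fun l : NH => (l.fam, l.toLab)) {l | l ∈ labs} := List.inj_on_of_nodup_map hkey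
  have hinj0 : Set.InjOn NH.toLab ↑S0 := by
    intro l hl l' hl' hll
    have hl2 := Finset.mem_filter.1 (Finset.mem_coe.1 hl); have hl2' := Finset.mem_filter.1 (Finset.mem_coe.1 hl')
    exact hinj_key (hSmem l hl2.1).1 (hSmem l' hl2'.1).1 (by simp [hll, hl2.2, hl2'.2])
  have hinj1 : Set.InjOn NH.toLab ↑S1 := by
    intro l hl l' hl' hll
    have hl2 := Finset.mem_filter.1 (Finset.mem_coe.1 hl); have hl2' := Finset.mem_filter.1 (Finset.mem_coe.1 hl')
    have e1 : l.fam = true := by simpa using hl2.2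
    have e2 : l'.fam = true := by simpa using hl2'.2
    exact hinj_key (hSmem l hl2.1).1 (hSmem l' hl2'.1).1 (by simp [hll, e1, e2])
  -- unshifted part = sum over the image, extended by zero to the box
  have h0img : ∑ l ∈ S0, Φ l = ∑ b ∈ S0.image NH.toLab, effPot w₄₅ ω₄ (3 / 400) ‖latPt U f b‖ := by
    rw [Finset.sum_image hinj0]
    exact Finset.sum_congr rfl fun l hl => hΦU l (Finset.mem_filter.1 hl).2
  have h1img : ∑ l ∈ S1, Φ l = ∑ b ∈ S1.image NH.toLab, effPot w₄₅ ω₄ (3 / 400) ‖latPt U f b + U t‖ := by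
    rw [Finset.sum_image hinj1]
    exact Finset.sum_congr rfl fun l hl => hΦS l (by simpa using (Finset.mem_filter.1 hl).2)
  have h0box : ∑ b ∈ S0.image NH.toLab, effPot w₄₅ ω₄ (3 / 400) ‖latPt U f b‖ = ∑ b ∈ box, effPot w₄₅ ω₄ (3 / 400) ‖latPt U f b‖ := by
    apply Finset.sum_subset
    · intro b hb
      obtain ⟨l, hl, rfl⟩ := Finset.mem_image.1 hb
      have hl2 := Finset.mem_filter.1 hl
      exact hmemU l (hSmem l hl2.1).1 hl2.2
    · intro b hb hnot
      refine effPot45_eq_far ?_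
      rcases hcovU b hb with ⟨l, hl, hlf, rfl⟩ | hfarb
      · -- the record is untreated (else its label would be in the image)
        have hnt : treatedH tab k l = false := by
          by_contra ht
          have ht' : treatedH tab k l = true := by simpa using ht
          exact hnot (Finset.mem_image.2 ⟨l, Finset.mem_filter.2 ⟨hSdef ▸ List.mem_toFinset.2 (List.mem_filter.2 ⟨hl, ht'⟩), hlf⟩, rfl⟩)
        have := hfar l hl hnt
        rw [sum_Lz_xH_of_fam_false U f t hlf] at this
        exact far_of_sq_ge this
      · exact hfarb
  have h1box : ∑ b ∈ S1.image NH.toLab, effPot w₄₅ ω₄ (3 / 400) ‖latPt U f b + U t‖ =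
      ∑ b ∈ boxF, effPot w₄₅ ω₄ (3 / 400) ‖latPt U f b + U t‖ := by
    apply Finset.sum_subset
    · intro b hb
      obtain ⟨l, hl, rfl⟩ := Finset.mem_image.1 hb
      have hl2 := Finset.mem_filter.1 hl
      exact hmemS l (hSmem l hl2.1).1 (by simpa using hl2.2)
    · intro b hb hnot
      refine effPot45_eq_far ?_
      rcases hcovS b hb with ⟨l, hl, hlf, rfl⟩ | hfarb
      · have hnt : treatedH tab k l = false := by
          by_contra ht
          have ht' : treatedH tab k l = true := by simpa using ht
          exact hnot (Finset.mem_image.2 ⟨l, Finset.mem_filter.2 ⟨hSdef ▸ List.mem_toFinset.2 (List.mem_filter.2 ⟨hl, ht'⟩), by simp [hlf]⟩, rfl⟩)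
        have := hfar l hl hnt
        rw [sum_Lz_xH_of_fam_true U f t hlf] at this
        exact far_of_sq_ge this
      · exact hfarb
  calc ((sgnZ sμ aμ : ℤ) : ℝ) / SC / 2 ≤ ∑ l ∈ S, Φ l := hpts
    _ = _ := by rw [hsplit, h0img, h1img, h0box, h1box]

/-! ## §3. The hcp frame: integer norms and far labels -/

/-- `nU9 b = 9‖P b‖²` (`P = latPt 1 hexFrame`). -/
def nU9 (b : Fin 3 → ℤ) : ℤ := 9 * (b 0 * b 0) + 9 * (b 0 * b 1) + 9 * (b 1 * b 1) + 24 * (b 2 * b 2)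

/-- `nS9 b = 9‖P b + hcpShift‖²`. -/
def nS9 (b : Fin 3 → ℤ) : ℤ := 9 * (b 0 * b 0) + 9 * (b 0 * b 1) + 9 * b 0 + 9 * (b 1 * b 1) + 9 * b 1 + 24 * (b 2 * b 2) + 24 * b 2 + 9

/-- [arithmetic] -/
theorem nU9_eq (b : Fin 3 → ℤ) : ((nU9 b : ℤ) : ℝ) = 9 * ‖latPt 1 hexFrame b‖ ^ 2 := by
  rw [norm_sq_hexPt]; unfold nU9; push_cast; ring

/-- [arithmetic] -/
theorem nS9_eq (b : Fin 3 → ℤ) : ((nS9 b : ℤ) : ℝ) = 9 * ‖latPt 1 hexFrame b + hcpShift‖ ^ 2 := by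
  rw [norm_sq_hexPt_add_shift]; unfold nS9; push_cast; ring

/-- ★ FAR unshifted labels: `‖U − 1‖ ≤ 1/4`, `nU9 b ≥ 324` (`‖P b‖ ≥ 6`) ⟹ `‖latPt U hexFrame b‖ ≥ 9/2`. [folklore] -/
theorem farU_of_nU9 {U : E3 →L[ℝ] E3} (hU : ‖U - 1‖ ≤ 1 / 4) {b : Fin 3 → ℤ} (hb : 324 ≤ nU9 b) : 9 / 2 ≤ ‖latPt U hexFrame b‖ := by
  have h9 : (324 : ℝ) ≤ 9 * ‖latPt 1 hexFrame b‖ ^ 2 := by rw [← nU9_eq]; exact_mod_cast hb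
  have h6 : (6 : ℝ) ≤ ‖latPt 1 hexFrame b‖ := by nlinarith [norm_nonneg (latPt 1 hexFrame b)]
  have happ := norm_apply_ge_of_near_one hU (latPt 1 hexFrame b)
  rw [← latPt_eq_apply_one] at happ
  linarith

/-- `|ξᵢ| ≤ 1/4` for all `i` ⟹ `‖ξ‖ ≤ 7/16` (`3/16 ≤ (7/16)²`). [arithmetic] -/
theorem norm_le_of_coord_le {ξ : E3} (hξ : ∀ i : Fin 3, |ξ i| ≤ 1 / 4) : ‖ξ‖ ≤ 7 / 16 := by
  have hsq : ‖ξ‖ ^ 2 ≤ 3 / 16 := by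
    rw [EuclideanSpace.norm_sq_eq, Fin.sum_univ_three, Real.norm_eq_abs, Real.norm_eq_abs, Real.norm_eq_abs]
    have h0 := hξ 0; have h1 := hξ 1; have h2 := hξ 2
    nlinarith [abs_nonneg (ξ 0), abs_nonneg (ξ 1), abs_nonneg (ξ 2)]
  nlinarith [norm_nonneg ξ]

/-- ★ FAR shifted labels: `‖U − 1‖ ≤ 1/4`, `|ξᵢ| ≤ 1/4`, `nS9 b ≥ 378` (`‖P b + hcpShift‖² ≥ 42`) ⟹ `‖latPt U hexFrame b + U (hcpShift + ξ)‖ ≥ 9/2`.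
[folklore] -/
theorem farS_of_nS9 {U : E3 →L[ℝ] E3} (hU : ‖U - 1‖ ≤ 1 / 4) {ξ : E3} (hξ : ∀ i : Fin 3, |ξ i| ≤ 1 / 4) {b : Fin 3 → ℤ} (hb : 378 ≤ nS9 b) :
    9 / 2 ≤ ‖latPt U hexFrame b + U (hcpShift + ξ)‖ := by
  have h9 : (378 : ℝ) ≤ 9 * ‖latPt 1 hexFrame b + hcpShift‖ ^ 2 := by rw [← nS9_eq]; exact_mod_cast hb
  have h6 : (103 : ℝ) / 16 ≤ ‖latPt 1 hexFrame b + hcpShift‖ := by nlinarith [norm_nonneg (latPt 1 hexFrame b + hcpShift)]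
  have hξn := norm_le_of_coord_le hξ
  have htri : ‖latPt 1 hexFrame b + hcpShift‖ - ‖ξ‖ ≤ ‖latPt 1 hexFrame b + hcpShift + ξ‖ := by
    have := norm_sub_le_norm_add (latPt 1 hexFrame b + hcpShift) ξ
    have e : ‖latPt 1 hexFrame b + hcpShift‖ - ‖ξ‖ ≤ |‖latPt 1 hexFrame b + hcpShift‖ - ‖ξ‖| := le_abs_self _
    linarith [abs_norm_sub_norm_le (latPt 1 hexFrame b + hcpShift) (-ξ), norm_neg ξ,
      show ‖latPt 1 hexFrame b + hcpShift - -ξ‖ = ‖latPt 1 hexFrame b + hcpShift + ξ‖ by rw [sub_neg_eq_add]]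
  have happ := norm_apply_ge_of_near_one hU (latPt 1 hexFrame b + hcpShift + ξ)
  rw [← shifted_eq_apply] at happ
  linarith

/-! ## §4. Coverage certificate and ★★★ the hcp soundness theorem -/

/-- The record is the unshifted record of `(x, y, z)`. -/
def NH.hitU (x y z : ℤ) (l : NH) : Bool := !l.fam && decide (l.b0 = x) && decide (l.b1 = y) && decide (l.b2 = z)

/-- The record is the shifted record of `(x, y, z)`. -/
def NH.hitS (x y z : ℤ) (l : NH) : Bool := l.fam && decide (l.b0 = x) && decide (l.b1 = y) && decide (l.b2 = z)

/-- A triple is covered: (zero, or unshifted-far, or an unshifted record) and (shifted-far or a shifted record). -/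
def coverTripleH (labs : List NH) (x y z : ℤ) : Bool :=
  (decide (x = 0 ∧ y = 0 ∧ z = 0) || decide (324 ≤ 9 * (x * x) + 9 * (x * y) + 9 * (y * y) + 24 * (z * z)) || labs.any (NH.hitU x y z)) &&
    (decide (378 ≤ 9 * (x * x) + 9 * (x * y) + 9 * x + 9 * (y * y) + 9 * y + 24 * (z * z) + 24 * z + 9) || labs.any (NH.hitS x y z))

/-- ★ Coverage check over `[−7,7]³`, both families. -/
def coverH (labs : List NH) : Bool :=
  (List.range 15).all fun i => (List.range 15).all fun j => (List.range 15).all fun k =>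
    coverTripleH labs ((i : ℤ) - 7) ((j : ℤ) - 7) ((k : ℤ) - 7)

/-- [formal bookkeeping] -/
theorem NH.toLab_of_hitU {x y z : ℤ} {l : NH} (h : l.hitU x y z = true) : l.fam = false ∧ l.toLab = ![x, y, z] := by
  unfold NH.hitU at h
  simp only [Bool.and_eq_true, decide_eq_true_eq, Bool.not_eq_true'] at h
  obtain ⟨⟨⟨hf, h0⟩, h1⟩, h2⟩ := h
  exact ⟨hf, by ext i; fin_cases i <;> simp [NH.toLab, h0, h1, h2]⟩

/-- [formal bookkeeping] -/
theorem NH.toLab_of_hitS {x y z : ℤ} {l : NH} (h : l.hitS x y z = true) : l.fam = true ∧ l.toLab = ![x, y, z] := by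
  unfold NH.hitS at h
  simp only [Bool.and_eq_true, decide_eq_true_eq] at h
  obtain ⟨⟨⟨hf, h0⟩, h1⟩, h2⟩ := h
  exact ⟨hf, by ext i; fin_cases i <;> simp [NH.toLab, h0, h1, h2]⟩

/-- ★ `coverH labs = true` ⟹ the two coverage hypotheses of `leafCheckH_sound_frame` for the hcp frame. [formal bookkeeping] -/
theorem cover_of_coverH {labs : List NH} (h : coverH labs = true) {U : E3 →L[ℝ] E3} (hU : ‖U - 1‖ ≤ 1 / 4) {ξ : E3}
    (hξ : ∀ i : Fin 3, |ξ i| ≤ 1 / 4) :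
    (∀ b ∈ (Fintype.piFinset fun _ : Fin 3 => Finset.Icc (-7 : ℤ) 7).filter (fun b => b ≠ 0),
      (∃ l ∈ labs, l.fam = false ∧ l.toLab = b) ∨ 9 / 2 ≤ ‖latPt U hexFrame b‖) ∧
    (∀ b ∈ (Fintype.piFinset fun _ : Fin 3 => Finset.Icc (-7 : ℤ) 7),
      (∃ l ∈ labs, l.fam = true ∧ l.toLab = b) ∨ 9 / 2 ≤ ‖latPt U hexFrame b + U (hcpShift + ξ)‖) := by
  -- evaluate the certificate at the indices of `b`
  have hat : ∀ b ∈ (Fintype.piFinset fun _ : Fin 3 => Finset.Icc (-7 : ℤ) 7), coverTripleH labs (b 0) (b 1) (b 2) = true := by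
    intro b hb
    rw [Fintype.mem_piFinset] at hb
    have hidx : ∀ t : Fin 3, ∃ n : ℕ, n < 15 ∧ (n : ℤ) - 7 = b t := fun t =>
      ⟨(b t + 7).toNat, by have := Finset.mem_Icc.1 (hb t); omega, by have := Finset.mem_Icc.1 (hb t); omega⟩
    obtain ⟨i, hi15, hi⟩ := hidx 0
    obtain ⟨j, hj15, hj⟩ := hidx 1
    obtain ⟨k, hk15, hk⟩ := hidx 2
    unfold coverH at h
    have h1 := List.all_eq_true.1 h i (List.mem_range.2 hi15)
    have h2 := List.all_eq_true.1 h1 j (List.mem_range.2 hj15)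
    have h3 := List.all_eq_true.1 h2 k (List.mem_range.2 hk15)
    rwa [hi, hj, hk] at h3
  have hbvec : ∀ b : Fin 3 → ℤ, b = ![b 0, b 1, b 2] := fun b => by ext t; fin_cases t <;> rfl
  refine ⟨fun b hb => ?_, fun b hb => ?_⟩
  · obtain ⟨hbF, hne⟩ := Finset.mem_filter.1 hb
    have h3 := hat b hbF
    unfold coverTripleH at h3
    simp only [Bool.and_eq_true, Bool.or_eq_true, decide_eq_true_eq, List.any_eq_true] at h3
    rcases h3.1 with (hz | hbig) | ⟨l, hl, hhit⟩
    · exact absurd (by rw [hbvec b]; ext t; fin_cases t <;> simp [hz.1, hz.2.1, hz.2.2]) hne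
    · exact Or.inr (farU_of_nU9 hU (by unfold nU9; linarith))
    · obtain ⟨hf, hlab⟩ := NH.toLab_of_hitU hhit
      exact Or.inl ⟨l, hl, hf, by rw [hlab, ← hbvec b]⟩
  · have h3 := hat b hb
    unfold coverTripleH at h3
    simp only [Bool.and_eq_true, Bool.or_eq_true, decide_eq_true_eq, List.any_eq_true] at h3
    rcases h3.2 with hbig | ⟨l, hl, hhit⟩
    · exact Or.inr (farS_of_nS9 hU hξ (by unfold nS9; linarith))
    · obtain ⟨hf, hlab⟩ := NH.toLab_of_hitS hhit
      exact Or.inl ⟨l, hl, hf, by rw [hlab, ← hbvec b]⟩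

/-- All records consistent. -/
def allOKH (labs : List NH) : Bool := labs.all NH.ok

/-- All records in their boxes: labels in `[−7,7]³`, unshifted labels non-zero. -/
def allInBoxH (labs : List NH) : Bool :=
  labs.all fun l => decide (-7 ≤ l.b0 ∧ l.b0 ≤ 7 ∧ -7 ≤ l.b1 ∧ l.b1 ≤ 7 ∧ -7 ≤ l.b2 ∧ l.b2 ≤ 7) &&
    (l.fam || !(decide (l.b0 = 0) && decide (l.b1 = 0) && decide (l.b2 = 0)))

/-- The ten class sums of a record list. -/
def sumMag (labs : List NH) (j : Fin 10) : ℕ := (labs.map (fun l => l.mag j)).sum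

/-- `allOKH` unpacked. [formal bookkeeping] -/
theorem ok_of_allOKH {labs : List NH} (h : allOKH labs = true) : ∀ l ∈ labs, l.ok = true := by
  unfold allOKH at h; exact List.all_eq_true.1 h

/-- `allInBoxH` unpacked. [formal bookkeeping] -/
theorem mem_of_allInBoxH {labs : List NH} (h : allInBoxH labs = true) :
    (∀ l ∈ labs, l.fam = false → l.toLab ∈ (Fintype.piFinset fun _ : Fin 3 => Finset.Icc (-7 : ℤ) 7).filter (fun b => b ≠ 0)) ∧
    (∀ l ∈ labs, l.fam = true → l.toLab ∈ (Fintype.piFinset fun _ : Fin 3 => Finset.Icc (-7 : ℤ) 7)) := by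
  unfold allInBoxH at h
  have h' := List.all_eq_true.1 h
  have hcube : ∀ l ∈ labs, l.toLab ∈ (Fintype.piFinset fun _ : Fin 3 => Finset.Icc (-7 : ℤ) 7) := by
    intro l hl
    have := h' l hl
    simp only [Bool.and_eq_true, decide_eq_true_eq] at this
    obtain ⟨⟨h0, h0', h1, h1', h2, h2'⟩, -⟩ := this
    rw [Fintype.mem_piFinset]; intro t
    fin_cases t <;> simp [NH.toLab, Finset.mem_Icc, h0, h0', h1, h1', h2, h2']
  refine ⟨fun l hl hf => Finset.mem_filter.2 ⟨hcube l hl, ?_⟩, fun l hl _ => hcube l hl⟩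
  have := h' l hl
  simp only [Bool.and_eq_true, decide_eq_true_eq, hf, Bool.false_or, Bool.not_eq_true', Bool.and_eq_false_iff,
    decide_eq_false_iff_not] at this
  obtain ⟨-, hnz⟩ := this
  intro hzero
  have e0 : l.b0 = 0 := by have := congrFun hzero 0; simpa [NH.toLab] using this
  have e1 : l.b1 = 0 := by have := congrFun hzero 1; simpa [NH.toLab] using this
  have e2 : l.b2 = 0 := by have := congrFun hzero 2; simpa [NH.toLab] using this
  rcases hnz with (h0 | h1) | h2
  · exact h0 e0
  · exact h1 e1
  · exact h2 e2

/-- Sort key of a record: an integer function of `(fam, b0, b1, b2)`, injective on `[−7,7]³`-labels (injectivity is not used: only that it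
FACTORS through `(fam, toLab)`). -/
def NH.keyZ (l : NH) : ℤ := famZ l.fam * 4096 + (l.b0 + 8) * 256 + (l.b1 + 8) * 16 + (l.b2 + 8)

/-- The list is strictly increasing in `keyZ`. -/
def chainLtH : List NH → Bool
  | [] => true
  | [_] => true
  | l :: l' :: ls => decide (l.keyZ < l'.keyZ) && chainLtH (l' :: ls)

/-- `chainLtH` ⟹ pairwise key order. [formal bookkeeping] -/
theorem pairwise_of_chainLtH : ∀ {ls : List NH}, chainLtH ls = true → ls.Pairwise (fun a b => a.keyZ < b.keyZ)
  | [], _ => List.Pairwise.nil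
  | [l], _ => List.pairwise_singleton _ l
  | l :: l' :: ls, h => by
    simp only [chainLtH, Bool.and_eq_true, decide_eq_true_eq] at h
    have ih := pairwise_of_chainLtH h.2
    refine List.Pairwise.cons ?_ ih
    intro x hx
    rcases List.mem_cons.1 hx with rfl | hx'
    · exact h.1
    · exact lt_trans h.1 (List.rel_of_pairwise_cons ih hx')

/-- ★ `chainLtH` ⟹ the records have pairwise distinct `(fam, label)` keys. [formal bookkeeping] -/
theorem keyNodup_of_chainLtH {ls : List NH} (h : chainLtH ls = true) : (ls.map (fun l => (l.fam, l.toLab))).Nodup := by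
  have hp := pairwise_of_chainLtH h
  unfold List.Nodup
  rw [List.pairwise_map]
  refine hp.imp (fun {a b} hab heq => ?_)
  simp only [Prod.mk.injEq] at heq
  obtain ⟨hf, hl⟩ := heq
  have e0 := congrFun hl 0
  have e1 := congrFun hl 1
  have e2 := congrFun hl 2
  simp only [NH.toLab, Matrix.cons_val_zero, Matrix.cons_val_one, Matrix.head_cons, Matrix.cons_val_two, Matrix.tail_cons] at e0 e1 e2
  have : a.keyZ = b.keyZ := by simp only [NH.keyZ, hf, e0, e1, e2]
  exact absurd this (ne_of_lt hab)

/-- ★★★ **SOUNDNESS OF THE hcp TABLE LEAF CHECK (hcp frame).**  With the once-certified list facts (`allOKH`, key-`Nodup`, `allInBoxH`, `coverH`, class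
sums) and a semantically certified table (v2 or v3 rows), a passing `leafCheckH` at the class box `k` gives, for every `U` with `‖U − 1‖ ≤ 1/4`, every `ξ` with `|ξᵢ| ≤ 1/4`, and class
point `xH U hexFrame (hcpShift + ξ)` in the box:
`±aμ/(2·SC) ≤ Σ_{b∈[−7,7]³∖0} W₄₅‖latPt U hexFrame b‖ + Σ_{b∈[−7,7]³} W₄₅‖latPt U hexFrame b + U(hcpShift + ξ)‖`. [folklore] -/
theorem leafCheckH_sound_hcp {tab : QT} {labs : List NH} {E A0 A1 A2 A3 A4 A5 A6 A7 A8 A9 : ℕ} {k : LH} {sμ : Bool} {aμ : ℕ}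
    (htab : TabSem E tab) (hok : allOKH labs = true) (hkey : (labs.map (fun l => (l.fam, l.toLab))).Nodup)
    (hin : allInBoxH labs = true) (hcov : coverH labs = true)
    (hA : ∀ j : Fin 10, sumMag labs j ≤ vec10 A0 A1 A2 A3 A4 A5 A6 A7 A8 A9 j)
    (h : leafCheckH tab labs E A0 A1 A2 A3 A4 A5 A6 A7 A8 A9 k sμ aμ = true)
    (U : E3 →L[ℝ] E3) (hU : ‖U - 1‖ ≤ 1 / 4) (ξ : E3) (hξ : ∀ i : Fin 3, |ξ i| ≤ 1 / 4)
    (hbox : ∀ j, |xH U hexFrame (hcpShift + ξ) j - ((k.cZ j : ℤ) : ℝ) / SC| ≤ ((k.wN j : ℕ) : ℝ) / SC) :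
    ((sgnZ sμ aμ : ℤ) : ℝ) / SC / 2 ≤
      ∑ b ∈ (Fintype.piFinset fun _ : Fin 3 => Finset.Icc (-7 : ℤ) 7).filter (fun b => b ≠ 0), effPot w₄₅ ω₄ (3 / 400) ‖latPt U hexFrame b‖ +
        ∑ b ∈ (Fintype.piFinset fun _ : Fin 3 => Finset.Icc (-7 : ℤ) 7), effPot w₄₅ ω₄ (3 / 400) ‖latPt U hexFrame b + U (hcpShift + ξ)‖ := by
  obtain ⟨hmU, hmS⟩ := mem_of_allInBoxH hin
  obtain ⟨hcU, hcS⟩ := cover_of_coverH hcov hU hξ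
  exact leafCheckH_sound_frame htab (ok_of_allOKH hok) hkey hA hmU hmS h hexFrame U (hcpShift + ξ) hbox hcU hcS

end Summit.AtomisticToContinuum.Crystallization.Theorems.FrustratedLawDichotomyStrainedPatchHomLeafTableCheckHcp

end
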